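import Summits.ABC.StewartYu.ArchG3RecLinesA
import HarnessLib

/-!
# The archimedean record `ArchG3Rec` — letter lines in closed form, file B: CURRENCIES

Support file (theorems only; no named facts). Cell `abc-stewartyu`, route `YuMatveevShapeRat`, crux r2 `ArchCoreRat`
(stmt-ABC-20502), line `arch-g3-frame`, seam (B) of `stub_recLinesArch` (p5's `ArchG3Rec.LinesClosed`; p1 proves the
letter lines). Everything in the closed lines is measured in the unit `Z = G·X·L`; this file records the floors of `Z` and
the conversion of every record letter into `Z`:
* `Z_floors`: `0 < Z`, `64(n+1)·L·WN ≤ Z` (the unit floor of `X`), `512(n+1)²·L ≤ Z` (the floor `64(n+1) ≤ X`);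
* `H_bounds`: `1 ≤ H ≤ G·X/(64(n+1))`, `G·X/(128(n+1)) ≤ H`; `L_H_le`: `L·H ≤ Z/(64(n+1))`;
* `Sd_log_le`: `Ŝ·log 2 ≤ (n+24)·log 2 + log K + log N ≤ 10n + 29 + log N`; `Sd_real_le_L`: `4(Ŝ+2) ≤ L`;
* `Tf_le_Tf00`: every order `Tf lev ν ≤ T₀ := Tf 0 0`; `Tf00_le`: `T₀ ≤ (33/2)(n+1)·L` (`n ≥ 2`); `Tf_ge`: `M/(n+2)³ ≤ Tf lev ν` with
  `8(n+1)·L/(n+2)³ ≤ M/(n+2)³` (real);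
* `Omega_le_L_WN`: `48·C_bⁿ·K·Ω ≤ L·WN`; `SAR_le`: `Σ A ≤ n·Ω`; `Amax_div_N_lt`: `A_max/N < L/2`; `Bv_real`: `1 ≤ Bv j ≤ N·L/(2A j)`;
* `L₀_real_le`: `L₀ ≤ 6XC_bⁿΩK/N + 1` and the `L₀`-COEFFICIENT `6XC_bⁿΩK/N ≤ Z/(4·yload_K)` (via `WN/(N·W) ≤ 1`); `yloadK_ge`: `3G + 26 ≤ yload_K`;
* `log_letters_le`: `log L ≤ L/2^21`, `log X ≤ X`, `log N ≤ WN`.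

## References
* [Nesterenko2003] Yu. V. Nesterenko, LNM 1819 (2003) — §3.5 (3.23)–(3.25), §4 (4.3)–(4.5).
-/

noncomputable section

open Finset Real

namespace Summit.ABC.StewartYu

namespace ArchG3Rec

open PadicG3Par (Cb Cb_pos)
open ArchG3Par (G K SdK yloadK G_eq eight_le_G G_pos one_le_K K_pos two_G_le_yloadK yloadK_pos K_le)

variable {n : ℕ} (P : ArchG3Rec n)

/-! ### The unit `Z` -/

/-- **floors of the unit**: `0 < Z`, `64(n+1)·L·WN ≤ Z`, `512(n+1)²·L ≤ Z`, and `X·L = Z/G`. [folklore] -/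
theorem Z_floors : 0 < P.Z ∧ 64 * ((n : ℝ) + 1) * P.L * P.WN ≤ P.Z ∧ 512 * ((n : ℝ) + 1) ^ 2 * P.L ≤ P.Z ∧
    (P.X : ℝ) * P.L = P.Z / G n := by
  obtain ⟨h64, -, hWN, -⟩ := P.X_floors
  have hG := G_pos n
  have hL : (0 : ℝ) < P.L := P.L_real.2.1
  have hX : (0 : ℝ) < P.X := by have := P.X_floors.2.1; linarith
  have h64r : 64 * ((n : ℝ) + 1) ≤ P.X := by exact_mod_cast h64
  rw [div_le_iff₀ hG] at hWN
  have hn0 : (0 : ℝ) ≤ (n : ℝ) + 1 := by positivity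
  have hprod := mul_nonneg (mul_nonneg (sub_nonneg.mpr h64r) hn0) hL.le
  refine ⟨by unfold Z; positivity, ?_, ?_, ?_⟩
  · unfold Z; nlinarith
  · unfold Z; rw [G_eq]; nlinarith
  · unfold Z; field_simp

/-! ### The Feldman block `H` -/

/-- **`H`**: `1 ≤ H`, `H ≤ G·X/(64(n+1))` and `G·X/(128(n+1)) ≤ H` (`G·X/(64(n+1)) = X/8 ≥ 8`). [cite: Nesterenko2003, (3.23)] -/
theorem H_bounds : (1 : ℝ) ≤ P.H ∧ (P.H : ℝ) ≤ G n * P.X / (64 * (n + 1)) ∧ G n * P.X / (128 * (n + 1)) ≤ P.H := by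
  have hX := P.X_floors.2.1
  have hy : G n * P.X / (64 * (n + 1)) = (P.X : ℝ) / 8 := by
    rw [G_eq]; field_simp; ring
  have hy2 : G n * P.X / (128 * (n + 1)) = (P.X : ℝ) / 16 := by
    rw [G_eq]; field_simp; ring
  have h8 : (8 : ℝ) ≤ (P.X : ℝ) / 8 := by linarith
  have hfl := Nat.floor_le (show (0 : ℝ) ≤ (P.X : ℝ) / 8 by positivity)
  have hfl2 := Nat.lt_floor_add_one ((P.X : ℝ) / 8)
  have h1 : (1 : ℝ) ≤ P.H := by exact_mod_cast P.end_floors.2.2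
  refine ⟨h1, ?_, ?_⟩
  · rw [hy]; unfold H; rw [hy]
    rcases max_choice 1 ⌊(P.X : ℝ) / 8⌋₊ with h | h <;> rw [h]
    · push_cast; linarith
    · exact hfl
  · rw [hy2]; unfold H; rw [hy]
    have h2 : (⌊(P.X : ℝ) / 8⌋₊ : ℝ) ≤ ((max 1 ⌊(P.X : ℝ) / 8⌋₊ : ℕ) : ℝ) := by exact_mod_cast le_max_right _ _
    linarith

/-- **`L·H ≤ Z/(64(n+1))`**. [folklore] -/
theorem L_H_le : (P.L : ℝ) * P.H ≤ P.Z / (64 * (n + 1)) := by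
  have h := P.H_bounds.2.1
  have hL : (0 : ℝ) ≤ P.L := Nat.cast_nonneg _
  have e : P.Z / (64 * (n + 1)) = P.L * (G n * P.X / (64 * (n + 1))) := by unfold Z; ring
  rw [e]
  exact mul_le_mul_of_nonneg_left h hL

/-! ### The depth -/

/-- **`Ŝ·log 2 ≤ (n+24)·log 2 + log K + log N`** (from `2^Ŝ ≤ 2^{n+24}·K·N`) and the numeric form `Ŝ·log 2 ≤ 10n + 29 + log N`
(`log K ≤ 9n + 12`, `log 2 ≤ 0.6932`). [cite: Nesterenko2003, (3.24)] -/
theorem Sd_log_le : (P.Sd : ℝ) * Real.log 2 ≤ (n + 24) * Real.log 2 + Real.log (K n) + Real.log P.N ∧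
    (P.Sd : ℝ) * Real.log 2 ≤ 10 * n + 29 + Real.log P.N := by
  have h := P.Sd_sandwich.2
  have hK := K_pos n
  have hN := P.N_facts.1
  have h1 : ((2 : ℝ)) ^ P.Sd ≤ (2 : ℝ) ^ (n + 24) * ((K n : ℝ) * P.N) := by exact_mod_cast h
  have h2 : Real.log ((2 : ℝ) ^ P.Sd) ≤ Real.log ((2 : ℝ) ^ (n + 24) * ((K n : ℝ) * P.N)) :=
    Real.log_le_log (by positivity) h1
  rw [Real.log_pow, Real.log_mul (by positivity) (by positivity), Real.log_pow, Real.log_mul hK.ne' hN.ne'] at h2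
  push_cast at h2
  have hA : (P.Sd : ℝ) * Real.log 2 ≤ (n + 24) * Real.log 2 + Real.log (K n) + Real.log P.N := by linarith
  refine ⟨hA, ?_⟩
  have hKl := ArchG3Rec.log_K_le (n := n) P.hn
  have hl2 : Real.log 2 ≤ 0.6932 := by have := Real.log_two_lt_d9; linarith
  have hn : (0 : ℝ) ≤ n := Nat.cast_nonneg n
  nlinarith

/-- `4(Ŝ+2) ≤ L` (real). [folklore] -/
theorem Sd_real_le_L : 4 * ((P.Sd : ℝ) + 2) ≤ P.L := by exact_mod_cast P.L_floors.2.2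

/-! ### The orders -/

/-- **every order is at most the START order**: `Tf lev ν ≤ Tf 0 0` (`R (lev+1) + T lev ≤ R 0`). [folklore] -/
theorem Tf_le_Tf00 (lev ν : ℕ) : P.Tf lev ν ≤ P.Tf 0 0 := by
  unfold Tf Mord
  have hR0 : P.R 0 = P.T 0 + P.R 1 := P.R_eq_add 0 (Nat.zero_le _)
  -- `R (lev+1) + T lev ≤ R 0`
  have hsub : P.R (lev + 1) + P.T lev ≤ P.R 0 := by
    rcases Nat.lt_or_ge P.Sd lev with h | h
    · rw [P.R_eq_zero (lev + 1) (by omega)]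
      have : P.T lev ≤ P.T 0 := by
        have h1 := (P.T_facts lev).2.1
        have h2 := (P.T_facts 0).2.2
        simp at h2; omega
      omega
    · -- `R lev = T lev + R (lev+1)` and `R lev ≤ R 0` (sub-sum over `Icc lev Ŝ ⊆ Icc 0 Ŝ`)
      rw [add_comm, ← P.R_eq_add lev h]
      unfold R
      exact Finset.sum_le_sum_of_subset (Finset.Icc_subset_Icc_left (Nat.zero_le _))
  have h3 : (n + 1 - ν) * P.T lev ≤ (n + 1) * P.T lev := Nat.mul_le_mul_right _ (Nat.sub_le _ _)
  simp only [Nat.sub_zero]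
  nlinarith

/-- **`T₀ ≤ (33/2)(n+1)·L`** for `n ≥ 2` (`16(n+1)L(1 + 1/64) + (n+1)Ŝ`, `Ŝ ≤ L/4`). [folklore] -/
theorem Tf00_le (hn2 : 2 ≤ n) : (P.Tf 0 0 : ℝ) ≤ 33 / 2 * ((n : ℝ) + 1) * P.L := by
  have h := P.Mord_zero_le
  have hL : (0 : ℝ) ≤ P.L := Nat.cast_nonneg _
  have hn : (2 : ℝ) ≤ n := by exact_mod_cast hn2
  have hSd := P.Sd_real_le_L
  have h64 : (64 : ℝ) ≤ ((n : ℝ) + 2) ^ 3 := by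
    have h4 : (4 : ℝ) ≤ (n : ℝ) + 2 := by linarith
    nlinarith [pow_le_pow_left₀ (by norm_num : (0:ℝ) ≤ 4) h4 3]
  have h3 : 1 / ((n : ℝ) + 2) ^ 3 ≤ 1 / 64 := div_le_div_of_nonneg_left zero_le_one (by norm_num) h64
  have h4 : 16 * ((n : ℝ) + 1) * P.L * (1 + 1 / ((n : ℝ) + 2) ^ 3) ≤ 16 * ((n : ℝ) + 1) * P.L * (1 + 1 / 64) :=
    mul_le_mul_of_nonneg_left (by linarith) (by positivity)
  unfold Tf
  nlinarith

/-- `(n+2)³ ≤ 2^{n+5}`. [folklore] -/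
theorem cube_le_two_pow (n : ℕ) : (n + 2) ^ 3 ≤ 2 ^ (n + 5) := by
  induction n with
  | zero => norm_num
  | succ m ih =>
    rcases Nat.lt_or_ge m 3 with hm | hm
    · interval_cases m <;> norm_num
    · have hk : 5 ≤ m + 2 := by omega
      have e1 : (m + 1 + 2) ^ 3 = (m + 2) ^ 3 + 3 * (m + 2) ^ 2 + 3 * (m + 2) + 1 := by ring
      have e2 : 5 * (m + 2) ^ 2 ≤ (m + 2) ^ 3 := by
        calc 5 * (m + 2) ^ 2 ≤ (m + 2) * (m + 2) ^ 2 := Nat.mul_le_mul_right _ hk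
          _ = (m + 2) ^ 3 := by ring
      have e3 : 5 * (m + 2) ≤ (m + 2) ^ 2 := by
        calc 5 * (m + 2) ≤ (m + 2) * (m + 2) := Nat.mul_le_mul_right _ hk
          _ = (m + 2) ^ 2 := by ring
      have e4 : 2 ^ (m + 1 + 5) = 2 * 2 ^ (m + 5) := by ring
      omega

/-- **the order floor**: `M/(n+2)³ ≤ Tf lev ν` with `8(n+1)·L/(n+2)³ ≤ M/(n+2)³` (real; `M = 16(n+1)L`, `16(n+1)L ≥ 2(n+2)³`… via
`L ≥ 2^{n+25}`), so `1 ≤ Tf lev ν` and `8(n+1)L ≤ (n+2)³·Tf lev ν`. [cite: Nesterenko2003, (4.5)] -/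
theorem Tf_ge (lev ν : ℕ) : 8 * ((n : ℝ) + 1) * P.L ≤ ((n : ℝ) + 2) ^ 3 * P.Tf lev ν ∧ (1 : ℝ) ≤ P.Tf lev ν := by
  have h := (P.Mord_facts lev ν).1
  have hL := P.L_floors.1
  have hc : (n + 2) ^ 3 ≤ 2 ^ (n + 5) := cube_le_two_pow n
  have hc2 : 2 ^ (n + 5) ≤ P.L := le_trans (Nat.pow_le_pow_right (by norm_num) (by omega)) hL
  have hpos : 0 < (n + 2) ^ 3 := by positivity
  have h1 : P.M < P.M / (n + 2) ^ 3 * (n + 2) ^ 3 + (n + 2) ^ 3 := Nat.lt_div_mul_add hpos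
  have hM : P.M = 2 * (8 * (n + 1) * P.L) := by unfold M; ring
  have hcL : (n + 2) ^ 3 ≤ 8 * (n + 1) * P.L := le_trans (hc.trans hc2) (Nat.le_mul_of_pos_left _ (by positivity))
  have h3 : 8 * (n + 1) * P.L ≤ P.M / (n + 2) ^ 3 * (n + 2) ^ 3 := by omega
  have h4 : 8 * (n + 1) * P.L ≤ P.Tf lev ν * (n + 2) ^ 3 := by
    unfold Tf; exact h3.trans (Nat.mul_le_mul_right _ h)
  refine ⟨?_, ?_⟩
  · have : ((8 * (n + 1) * P.L : ℕ) : ℝ) ≤ ((P.Tf lev ν * (n + 2) ^ 3 : ℕ) : ℝ) := by exact_mod_cast h4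
    push_cast at this; linarith
  · rcases Nat.eq_zero_or_pos (P.Tf lev ν) with hz | hz
    · rw [hz] at h4; simp at h4; omega
    · exact_mod_cast hz

/-! ### The weights against `L` -/

/-- **`48·C_bⁿ·K·Ω ≤ L·WN`** (the core `24C_bⁿΩK·yload_K·W ≤ G·WN·L` with `yload_K ≥ 2G`, `W ≥ 1`). [cite: Nesterenko2003, (3.23)] -/
theorem Omega_le_L_WN : 48 * Cb ^ n * K n * P.Ω ≤ P.L * P.WN := by
  have h := P.core_le_L.1
  have hy := two_G_le_yloadK n
  have hG := G_pos n
  have hW := P.hW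
  have hc : 0 ≤ 24 * Cb ^ n * P.Ω * K n := by
    have := P.Ω_facts.1; have := K_pos n; have := Cb_pos; positivity
  have hc2 : 0 ≤ 24 * Cb ^ n * P.Ω * K n * yloadK n := mul_nonneg hc (yloadK_pos n).le
  have h1 : 24 * Cb ^ n * P.Ω * K n * (2 * G n) * 1 ≤ 24 * Cb ^ n * P.Ω * K n * yloadK n * P.W :=
    mul_le_mul (mul_le_mul_of_nonneg_left hy hc) hW zero_le_one hc2
  nlinarith

/-- `Σ A ≤ n·Ω`, `AθsumR ≤ n·Σ A`, `0 ≤ Σ A`. [folklore] -/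
theorem SAR_le : P.SAR ≤ n * P.Ω ∧ P.AθsumR ≤ n * P.SAR ∧ 0 ≤ P.SAR := by
  have hA := P.A_facts
  have hΩ := P.Ω_facts
  have h1 : P.SAR ≤ n * P.Ω := by
    unfold SAR
    calc ∑ j, P.A j ≤ ∑ _j : Fin n, P.Ω := sum_le_sum fun j _ => ((hA j).2.2).trans hΩ.2.2.1
      _ = n * P.Ω := by simp
  have h0 : 0 ≤ P.SAR := by unfold SAR; exact sum_nonneg fun j _ => (hA j).1.le
  refine ⟨h1, ?_, h0⟩
  unfold AθsumR AθR
  calc ∑ k, ∑ j ∈ Iic k, P.A j ≤ ∑ _k : Fin n, P.SAR :=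
        sum_le_sum fun k _ => by
          unfold SAR; exact sum_le_sum_of_subset_of_nonneg (subset_univ _) fun j _ _ => (hA j).1.le
    _ = n * P.SAR := by simp

/-- `A_max/N < L/2` (the box floor `2A_max/N < L`) and `A j/N ≤ L/2`. [folklore] -/
theorem Amax_div_N_lt (j : Fin n) : P.Amax / P.N < (P.L : ℝ) / 2 ∧ P.A j / P.N ≤ (P.L : ℝ) / 2 := by
  have h := P.L_real.2.2.2
  have hN := P.N_facts.1
  have hA := (P.A_facts j).2.2
  have h1 : P.Amax / P.N < (P.L : ℝ) / 2 := by
    rw [div_lt_iff₀ hN] at h; rw [div_lt_div_iff₀ hN (by norm_num)]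
    linarith
  exact ⟨h1, le_trans (div_le_div_of_nonneg_right hA hN.le) h1.le⟩

/-- **the box**: `1 ≤ Bv j`, `Bv j ≤ N·L/(2A j)`, hence `2Bv j + 1 ≤ N·L/A j + 1 ≤ N·L + 1`. [folklore] -/
theorem Bv_real (j : Fin n) : (1 : ℝ) ≤ P.Bv j ∧ (P.Bv j : ℝ) ≤ P.N * P.L / (2 * P.A j) ∧
    2 * (P.Bv j : ℝ) + 1 ≤ P.N * P.L / P.A j + 1 ∧ 2 * (P.Bv j : ℝ) + 1 ≤ P.N * P.L + 1 := by
  obtain ⟨-, -, h1, h2⟩ := P.box_facts j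
  obtain ⟨hA0, hA1, -⟩ := P.A_facts j
  have hN := P.N_facts.1
  have hL : (0 : ℝ) ≤ P.L := Nat.cast_nonneg _
  have e : P.N * P.σ j = P.N * P.L / (2 * P.A j) := by unfold σ; ring
  rw [e] at h2
  have h3 : 2 * (P.Bv j : ℝ) + 1 ≤ P.N * P.L / P.A j + 1 := by
    have : 2 * (P.N * P.L / (2 * P.A j)) = P.N * P.L / P.A j := by field_simp
    linarith
  have h4 : P.N * P.L / P.A j ≤ P.N * P.L := div_le_self (by positivity) hA1
  exact ⟨by exact_mod_cast h1, h2, h3, by linarith⟩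

/-! ### The `Y₀`-degree `L₀` -/

/-- `WN/(N·W) ≤ 1`, i.e. `W + log N ≤ N·W` (`1 + log N ≤ N`, `W ≥ 1`). [folklore] -/
theorem WN_le_N_W : P.WN ≤ P.N * P.W := by
  have hN := P.N_facts
  have hW := P.hW
  have h1 : Real.log (P.N : ℝ) ≤ (P.N : ℝ) - 1 := Real.log_le_sub_one_of_pos hN.1
  unfold WN; nlinarith

/-- **`yload_K ≥ 3G + 26`** (`⌊log₂ K⌋·log 2 > G + 2 − log 2` as `K ≥ e^{G+2}`). [folklore] -/
theorem yloadK_ge (hn : 1 ≤ n) : 3 * G n + 26 ≤ yloadK n := by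
  have hG := G_pos n
  have hl2 : Real.log 2 ≤ 0.6932 := by have := Real.log_two_lt_d9; linarith
  have hl2' : 0.6931 ≤ Real.log 2 := by have := Real.log_two_gt_d9; linarith
  -- `K ≥ e^{G+2}`
  have hK : Real.exp (G n + 2) ≤ K n := by
    unfold K; push_cast
    have h1 := Nat.le_ceil ((n : ℝ) * Real.exp (G n + 2))
    have hn1 : (1 : ℝ) ≤ n := by exact_mod_cast hn
    nlinarith [Real.exp_pos (G n + 2)]
  -- `2^(Nat.log 2 K + 1) > K`
  have h2 : (K n : ℝ) < (2 : ℝ) ^ (Nat.log 2 (K n) + 1) := by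
    exact_mod_cast Nat.lt_pow_succ_log_self (b := 2) (by norm_num) (K n)
  have h3 : G n + 2 < (Nat.log 2 (K n) + 1 : ℝ) * Real.log 2 := by
    have := Real.log_lt_log (Real.exp_pos _) (lt_of_le_of_lt hK h2)
    rw [Real.log_exp, Real.log_pow] at this
    push_cast at this
    linarith
  have hlogn : 0 ≤ Real.log ((n : ℝ) + 1) := Real.log_nonneg (by have : (0:ℝ) ≤ n := Nat.cast_nonneg n; linarith)
  unfold yloadK SdK
  push_cast
  have hn0 : (0 : ℝ) ≤ n := Nat.cast_nonneg n
  have hlk : (0 : ℝ) ≤ (Nat.log 2 (K n) : ℝ) := Nat.cast_nonneg _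
  nlinarith

/-- **the `L₀`-coefficient**: `L₀ ≤ 6XC_bⁿΩK/N + 1` and `6XC_bⁿΩK/N ≤ Z·WN/(4·yload_K·N·W) ≤ Z/(4·yload_K)`.
[cite: Nesterenko2003, (3.23)] -/
theorem L₀_real_le : (P.L₀ : ℝ) ≤ 6 * P.X * Cb ^ n * P.Ω * K n / P.N + 1 ∧
    6 * P.X * Cb ^ n * P.Ω * K n / P.N ≤ P.Z / (4 * yloadK n) ∧ (P.L₀ : ℝ) ≤ P.Z / (4 * yloadK n) + 1 := by
  have h0 := P.L₀_lt
  have hcore := P.core_le_L.1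
  have hN := P.N_facts
  have hy := yloadK_pos n
  have hG := G_pos n
  have hW := P.hW
  have hX : (0 : ℝ) ≤ P.X := Nat.cast_nonneg _
  have hWN := P.WN_le_N_W
  have hWN0 := P.WN_bounds.2.2.2
  -- `6XC_bⁿΩK/N ≤ Z/(4 yloadK)`:  `24C_bⁿΩK·yloadK·W ≤ G·WN·L ≤ G·N·W·L`
  have h1 : 24 * Cb ^ n * P.Ω * K n * yloadK n * P.W ≤ G n * (P.N * P.W) * P.L := by
    have hL : (0 : ℝ) ≤ G n * P.L := by have := P.L_real.2.1; positivity
    nlinarith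
  have h2 : 6 * P.X * Cb ^ n * P.Ω * K n / P.N ≤ P.Z / (4 * yloadK n) := by
    rw [div_le_div_iff₀ hN.1 (by positivity)]
    unfold Z
    have : 6 * P.X * Cb ^ n * P.Ω * K n * (4 * yloadK n) * P.W ≤ G n * (P.X * P.L) * P.N * P.W := by nlinarith
    have hW0 : (0 : ℝ) < P.W := by linarith
    nlinarith
  exact ⟨h0.le, h2, by linarith⟩

/-! ### Logarithms against their arguments -/

/-- `log x ≤ x/2^21` for `x ≥ 2^26` (so for `x := L`). [folklore] -/
theorem log_le_div_of_ge {x : ℝ} (hx : (2 : ℝ) ^ 26 ≤ x) : Real.log x ≤ x / 2 ^ 21 := by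
  -- `log x = 26 log 2 + log (x/2^26) ≤ 26·0.7 + (x/2^26 − 1) ≤ x/2^21`
  have hx0 : 0 < x := lt_of_lt_of_le (by positivity) hx
  have h1 : Real.log x = 26 * Real.log 2 + Real.log (x / 2 ^ 26) := by
    rw [Real.log_div hx0.ne' (by positivity), Real.log_pow]; ring
  have h2 : Real.log (x / 2 ^ 26) ≤ x / 2 ^ 26 - 1 := Real.log_le_sub_one_of_pos (by positivity)
  have hl2 : Real.log 2 ≤ 0.6932 := by have := Real.log_two_lt_d9; linarith
  rw [h1]; nlinarith

/-- `log L ≤ L/2^21`, `log X ≤ X`, `log N ≤ WN`, `0 ≤ log L`, `0 ≤ log X`. [folklore] -/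
theorem log_letters_le : Real.log P.L ≤ (P.L : ℝ) / 2 ^ 21 ∧ Real.log P.X ≤ (P.X : ℝ) ∧ Real.log P.N ≤ P.WN ∧
    0 ≤ Real.log (P.L : ℝ) ∧ 0 ≤ Real.log (P.X : ℝ) := by
  obtain ⟨hL1, hL0, hL25, -⟩ := P.L_real
  have hX := P.X_floors.2.1
  have h26 : (2 : ℝ) ^ 26 ≤ P.L := le_trans (pow_le_pow_right₀ (by norm_num) (by have := P.hn; omega)) hL25
  refine ⟨log_le_div_of_ge h26, ?_, P.WN_bounds.2.2.1, Real.log_nonneg hL1, Real.log_nonneg (by linarith)⟩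
  have := Real.log_le_sub_one_of_pos (show (0:ℝ) < P.X by linarith)
  linarith

end ArchG3Rec

end Summit.ABC.StewartYu
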